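import Summits.QuantumFields.YangMills.Theorems.ParabolicTrajectoryContinuumLimitOnTrajectoryStubOSLegsA_Lattice
import Mathlib.Analysis.LocallyConvex.HahnBanach

/-!
# Stub `stub_osLegs` (line `two-orbit-synchronisation`), part B: `⁰𝒮` bookkeeping, the ultralimit functional,
the two missing hypotheses `ARP`/`UCL` with the corrected statement `OneFieldOSLegs'`, and the limit functionals

See part A (`…StubOSLegsA_Lattice`) for the analysis. §D (`ARP`, `UCL`, `OneFieldOSLegs'`) HAS BEEN moved verbatim
into the Defs file when the lead reshapes the skeleton (then delete it here).
-/


set_option autoImplicit false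

open scoped SchwartzMap
open MeasureTheory Filter Topology
open Literature.MathematicalPhysics.QuantumFieldTheory Literature.MathematicalPhysics.QuantumLattice
open Literature.MathematicalPhysics.AQFT Literature.Probability.LatticeModels
open Summit.QuantumFields.YangMills.Theses.ParabolicTrajectory

noncomputable section

namespace Summit.QuantumFields.YangMills.Cruxes.ContinuumLimitOnTrajectory.TwoOrbitSynchronisation

local notation "𝔼" => EuclideanSpace ℝ (Fin 4)

/-! ## §B  `⁰𝒮` bookkeeping: stability of off-diagonal test functions, OS tensors are off-diagonal (class (i)) -/

section OffDiagonal

open Literature.MathematicalPhysics.AQFT (IsOffDiagonal coincidenceLocus mem_coincidenceLocus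
  not_mem_coincidenceLocus_of_injective)

variable {n m : ℕ}

/-- The off-diagonal test functions form a subspace of `𝓢((ℝ⁴)ⁿ, ℂ)` (`⁰𝒮`). -/
def offDiag (n : ℕ) : Submodule ℂ (𝓢((Fin n → 𝔼), ℂ)) where
  carrier := {F | IsOffDiagonal F}
  add_mem' hF hG := hF.add hG
  zero_mem' := Literature.MathematicalPhysics.AQFT.isOffDiagonal_zero
  smul_mem' c _ hF := hF.smul c

/-- Membership in `offDiag`. -/
@[simp] theorem mem_offDiag {F : 𝓢((Fin n → 𝔼), ℂ)} : F ∈ offDiag n ↔ IsOffDiagonal F := Iff.rfl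

/-- With at most one point there is no coincidence: every test function is off-diagonal. -/
theorem isOffDiagonal_of_subsingleton [Subsingleton (Fin n)] (F : 𝓢((Fin n → 𝔼), ℂ)) : IsOffDiagonal F := by
  intro x hx
  obtain ⟨i, j, hij, -⟩ := hx
  exact absurd (Subsingleton.elim i j) hij

/-- Precomposition with a continuous linear equivalence preserving the coincidence locus preserves `⁰𝒮`. -/
theorem isOffDiagonal_comp_equiv {F F' : 𝓢((Fin n → 𝔼), ℂ)} (g : (Fin n → 𝔼) ≃L[ℝ] (Fin n → 𝔼))
    (hg : ∀ x, x ∈ coincidenceLocus n 𝔼 → g x ∈ coincidenceLocus n 𝔼)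
    (hFg : ∀ x, F' x = F (g x)) (hF : IsOffDiagonal F) : IsOffDiagonal F' := by
  intro x hx k
  have hfun : (F' : (Fin n → 𝔼) → ℂ) =
      (F : (Fin n → 𝔼) → ℂ) ∘ ⇑(g : (Fin n → 𝔼) →L[ℝ] (Fin n → 𝔼)) := funext hFg
  rw [hfun, (g : (Fin n → 𝔼) →L[ℝ] (Fin n → 𝔼)).iteratedFDeriv_comp_right (F.smooth k) x le_rfl]
  have h0 : iteratedFDeriv ℝ k (F : (Fin n → 𝔼) → ℂ) ((g : (Fin n → 𝔼) →L[ℝ] (Fin n → 𝔼)) x) = 0 :=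
    hF (g x) (hg x hx) k
  rw [h0]
  ext v
  rw [ContinuousMultilinearMap.compContinuousLinearMap_apply]
  rfl

/-- `⁰𝒮` is stable under diagonal translations. -/
theorem isOffDiagonal_translateMulti {F : 𝓢((Fin n → 𝔼), ℂ)} (hF : IsOffDiagonal F) (a : 𝔼) :
    IsOffDiagonal (translateMulti a F) := by
  intro x hx k
  have hfun : (translateMulti a F : (Fin n → 𝔼) → ℂ) = fun z => F (z - fun _ => a) := by
    funext z; rw [translateMulti_apply]; rfl
  rw [hfun, iteratedFDeriv_comp_sub]
  refine hF _ ?_ k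
  obtain ⟨i, j, hij, h⟩ := hx
  exact ⟨i, j, hij, by simp [h]⟩

/-- `⁰𝒮` is stable under the diagonal action of linear isometries. -/
theorem isOffDiagonal_linActMulti {F : 𝓢((Fin n → 𝔼), ℂ)} (hF : IsOffDiagonal F) (R : 𝔼 ≃ₗᵢ[ℝ] 𝔼) :
    IsOffDiagonal (linActMulti R F) := by
  refine isOffDiagonal_comp_equiv
    (ContinuousLinearEquiv.piCongrRight fun _ : Fin n => R.symm.toContinuousLinearEquiv) ?_ ?_ hF
  · rintro x ⟨i, j, hij, h⟩
    exact ⟨i, j, hij, by simp [h]⟩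
  · intro x
    rw [linActMulti_apply]
    rfl

/-- `⁰𝒮` is stable under permutations of the arguments. -/
theorem isOffDiagonal_permTest {F : 𝓢((Fin n → 𝔼), ℂ)} (hF : IsOffDiagonal F) (σ : Equiv.Perm (Fin n)) :
    IsOffDiagonal (permTest σ F) := by
  refine isOffDiagonal_comp_equiv ((LinearEquiv.funCongrLeft ℝ 𝔼 σ).toContinuousLinearEquiv) ?_ ?_ hF
  · rintro x ⟨i, j, hij, h⟩
    refine ⟨σ.symm i, σ.symm j, fun h' => hij (σ.symm.injective h'), ?_⟩
    change x (σ (σ.symm i)) = x (σ (σ.symm j))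
    simpa using h
  · intro x
    rw [permTest_apply]
    rfl

/-- Support of a reflected time-ordered test function: all times negative and pairwise distinct. -/
theorem tsupport_osAdjoint_subset {F : 𝓢((Fin n → 𝔼), ℂ)} (hF : IsTimeOrdered F) :
    tsupport (osAdjoint F : (Fin n → 𝔼) → ℂ) ⊆
      {x | (∀ i, x i 0 < 0) ∧ Function.Injective fun i => x i 0} := by
  -- `osAdjoint F = conj ∘ F ∘ ψ`, `ψ x = (θ x_{rev i})ᵢ`
  let ψ : (Fin n → 𝔼) → (Fin n → 𝔼) := fun x i => timeReflection 4 (x (Fin.rev i))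
  have hψ : Continuous ψ :=
    continuous_pi fun i => (timeReflection 4).continuous.comp (continuous_apply _)
  have hfun : (osAdjoint F : (Fin n → 𝔼) → ℂ) = star ∘ ((F : (Fin n → 𝔼) → ℂ) ∘ ψ) := by
    funext x; simp [ψ, osAdjoint_apply]
  have hsupp : tsupport (osAdjoint F : (Fin n → 𝔼) → ℂ) ⊆ ψ ⁻¹' tsupport (F : (Fin n → 𝔼) → ℂ) := by
    rw [hfun]
    refine (closure_mono ?_).trans
      (Summit.QuantumFields.YangMills.Theorems.ContinuumLimitOnTrajectory.Negative.tsupport_comp_subset_preimage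
        (F : (Fin n → 𝔼) → ℂ) hψ)
    intro x hx
    simpa [Function.mem_support] using hx
  intro x hx
  have h := hF (hsupp hx)
  simp only [Set.mem_setOf_eq, ψ, timeReflection_apply, if_true] at h
  obtain ⟨hpos, hmono⟩ := h
  refine ⟨fun i => ?_, fun i j hij => ?_⟩
  · have := hpos (Fin.rev i)
    rw [Fin.rev_rev] at this
    linarith
  · have hinj := hmono.injective
    have : Fin.rev i = Fin.rev j := hinj (by
      show -x (Fin.rev (Fin.rev i)) 0 = -x (Fin.rev (Fin.rev j)) 0
      rw [Fin.rev_rev, Fin.rev_rev]; exact congrArg Neg.neg hij)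
    exact Fin.rev_injective this

/-- Support of a time-ordered test function translated by `v` with `v⁰ ≥ 0`: all times positive, distinct. -/
theorem tsupport_translateMulti_subset {G' : 𝓢((Fin m → 𝔼), ℂ)} (hG : IsTimeOrdered G') {v : 𝔼}
    (hv : 0 ≤ v 0) :
    tsupport (translateMulti v G' : (Fin m → 𝔼) → ℂ) ⊆
      {x | (∀ i, 0 < x i 0) ∧ Function.Injective fun i => x i 0} := by
  let ψ : (Fin m → 𝔼) → (Fin m → 𝔼) := fun x i => x i - v
  have hψ : Continuous ψ := continuous_pi fun i => (continuous_apply i).sub continuous_const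
  have hfun : (translateMulti v G' : (Fin m → 𝔼) → ℂ) = (G' : (Fin m → 𝔼) → ℂ) ∘ ψ := by
    funext x; simp [ψ, translateMulti_apply]
  intro x hx
  rw [hfun] at hx
  have h := hG (Summit.QuantumFields.YangMills.Theorems.ContinuumLimitOnTrajectory.Negative.tsupport_comp_subset_preimage
    (G' : (Fin m → 𝔼) → ℂ) hψ hx)
  simp only [Set.mem_setOf_eq, ψ, PiLp.sub_apply] at h
  obtain ⟨hpos, hmono⟩ := h
  refine ⟨fun i => by linarith [hpos i], fun i j hij => hmono.injective ?_⟩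
  show x i 0 - v 0 = x j 0 - v 0
  rw [show x i 0 = x j 0 from hij]

/-- **OS tensors are in `⁰𝒮`**: `θF* ⊗ G_{(v)}` with `F`, `G` time-ordered and `v⁰ ≥ 0` (the test functions of
E2 with `v = 0`, of E4 with `v = t • a` spatial, of `HasMassGap` with `v = t e₀`) has all time coordinates pairwise
distinct on its support, hence vanishes to infinite order on the coincidence locus. -/
theorem isOffDiagonal_of_isAppendTensorOf {F : 𝓢((Fin n → 𝔼), ℂ)} {G' : 𝓢((Fin m → 𝔼), ℂ)}
    (hF : IsTimeOrdered F) (hG : IsTimeOrdered G') {v : 𝔼} (hv : 0 ≤ v 0)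
    {H : 𝓢((Fin (n + m) → 𝔼), ℂ)} (hH : IsAppendTensorOf H (osAdjoint F) (translateMulti v G')) :
    IsOffDiagonal H := by
  apply Literature.MathematicalPhysics.AQFT.IsOffDiagonal.of_tsupport_subset
  -- the support of `H` lies in the closed set `A`
  let A : Set (Fin (n + m) → 𝔼) :=
    {z | z ∘ Fin.castAdd m ∈ tsupport (osAdjoint F : (Fin n → 𝔼) → ℂ) ∧
      z ∘ Fin.natAdd n ∈ tsupport (translateMulti v G' : (Fin m → 𝔼) → ℂ)}
  have hc1 : Continuous fun z : Fin (n + m) → 𝔼 => z ∘ Fin.castAdd m :=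
    continuous_pi fun i => continuous_apply _
  have hc2 : Continuous fun z : Fin (n + m) → 𝔼 => z ∘ Fin.natAdd n :=
    continuous_pi fun i => continuous_apply _
  have hA : IsClosed A := ((isClosed_tsupport _).preimage hc1).inter ((isClosed_tsupport _).preimage hc2)
  have hsupp : Function.support (H : (Fin (n + m) → 𝔼) → ℂ) ⊆ A := by
    intro z hz
    rw [Function.mem_support, hH z] at hz
    exact ⟨subset_closure (Function.mem_support.2 (left_ne_zero_of_mul hz)),
      subset_closure (Function.mem_support.2 (right_ne_zero_of_mul hz))⟩
  refine (closure_minimal hsupp hA).trans ?_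
  rintro z ⟨hz1, hz2⟩
  obtain ⟨hneg, hinj1⟩ := tsupport_osAdjoint_subset hF hz1
  obtain ⟨hpos, hinj2⟩ := tsupport_translateMulti_subset hG hv hz2
  refine not_mem_coincidenceLocus_of_injective fun p q hpq => ?_
  have ht : z p 0 = z q 0 := by rw [hpq]
  induction p using Fin.addCases with
  | left i =>
    induction q using Fin.addCases with
    | left j => exact congrArg (Fin.castAdd m) (hinj1 (by simpa using ht))
    | right j =>
      exfalso
      have h1 := hneg i; have h2 := hpos j
      simp only [Function.comp_apply] at h1 h2
      linarith
  | right i =>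
    induction q using Fin.addCases with
    | left j =>
      exfalso
      have h1 := hpos i; have h2 := hneg j
      simp only [Function.comp_apply] at h1 h2
      linarith
    | right j => exact congrArg (Fin.natAdd n) (hinj2 (by simpa using ht))

/-- The E2 case `v = 0`. -/
theorem isOffDiagonal_of_isAppendTensorOf_zero {F : 𝓢((Fin n → 𝔼), ℂ)} {G' : 𝓢((Fin m → 𝔼), ℂ)}
    (hF : IsTimeOrdered F) (hG : IsTimeOrdered G')
    {H : 𝓢((Fin (n + m) → 𝔼), ℂ)} (hH : IsAppendTensorOf H (osAdjoint F) G') : IsOffDiagonal H := by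
  refine isOffDiagonal_of_isAppendTensorOf hF hG (v := 0) le_rfl (H := H) fun x => ?_
  rw [hH x, map_zero_translateMulti]
where
  /-- translation by `0` is the identity -/
  map_zero_translateMulti : translateMulti (0 : 𝔼) G' = G' := by ext x; simp [translateMulti_apply]

end OffDiagonal

/-! ## §C  The limit functional: ultralimit on `⁰𝒮` + Hahn–Banach (class (i); replaces "products are total in
`⁰𝒮` + Banach–Steinhaus", which would need a density theorem absent from Mathlib and the tree) -/

section Ultralimit

variable {X : Type*} [AddCommGroup X] [Module ℂ X] [TopologicalSpace X] [PolynormableSpace ℂ X]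

/-- **Ultralimit functional.** Along a fixed ultrafilter `𝒰` finer than `atTop`, linear functionals `u k` that are
eventually dominated on a subspace `W` by a continuous seminorm `q` converge along `𝒰` on `W` to a linear functional
dominated by `q`, which Hahn–Banach (Mathlib, polynormable spaces) extends to a continuous linear functional on `X`.
All axioms of the limit are then read off `Tendsto … 𝒰 (𝓝 (Λ x))` (uniqueness of limits, `le_of_tendsto`). -/
theorem exists_clm_ultralimit (𝒰 : Ultrafilter ℕ) (h𝒰 : (𝒰 : Filter ℕ) ≤ atTop)
    (W : Submodule ℂ X) (q : Seminorm ℂ X) (hq : Continuous q)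
    (u : ℕ → X →ₗ[ℂ] ℂ) (hu : ∀ x ∈ W, ∀ᶠ k in atTop, ‖u k x‖ ≤ q x) :
    ∃ Λ : X →L[ℂ] ℂ, (∀ x ∈ W, Tendsto (fun k => u k x) 𝒰 (𝓝 (Λ x))) ∧ ∀ x, ‖Λ x‖ ≤ q x := by
  -- ultralimits exist on `W` (bounded complex sequences converge along an ultrafilter)
  have hex : ∀ x ∈ W, ∃ c : ℂ, Tendsto (fun k => u k x) 𝒰 (𝓝 c) := by
    intro x hx
    have hle : (↑(𝒰.map fun k => u k x) : Filter ℂ) ≤ 𝓟 (Metric.closedBall (0 : ℂ) (q x)) := by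
      rw [Ultrafilter.coe_map, Filter.le_principal_iff, Filter.mem_map]
      exact h𝒰 ((hu x hx).mono fun k hk => mem_closedBall_zero_iff.2 hk)
    obtain ⟨c, -, hc⟩ := (isCompact_closedBall (0 : ℂ) (q x)).ultrafilter_le_nhds _ hle
    exact ⟨c, by rwa [Ultrafilter.coe_map] at hc⟩
  haveI : (𝒰 : Filter ℕ).NeBot := inferInstance
  have hT : ∀ x ∈ W, Tendsto (fun k => u k x) 𝒰 (𝓝 (limUnder (𝒰 : Filter ℕ) fun k => u k x)) :=
    fun x hx => tendsto_nhds_limUnder (hex x hx)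
  -- the ultralimit is linear on `W` and dominated by `q`
  let ℓ : W →ₗ[ℂ] ℂ :=
    { toFun := fun x => limUnder (𝒰 : Filter ℕ) fun k => u k (x : X)
      map_add' := fun x y => by
        refine tendsto_nhds_unique (hT _ (W.add_mem x.2 y.2)) ?_
        have := (hT x x.2).add (hT y y.2)
        simpa using this
      map_smul' := fun c x => by
        refine tendsto_nhds_unique (hT _ (W.smul_mem c x.2)) ?_
        have := (hT x x.2).const_mul c
        simpa using this }
  have hℓ : ∀ x : W, ‖ℓ x‖ ≤ q x := fun x =>
    le_of_tendsto (hT x x.2).norm (h𝒰 (hu x x.2))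
  obtain ⟨Λ, hΛW, hΛq⟩ := Module.Dual.exists_continuous_extension_of_le_seminorm W ℓ hq hℓ
  refine ⟨Λ, fun x hx => ?_, hΛq⟩
  have h := hΛW ⟨x, hx⟩
  simp only at h
  rw [show (Λ x : ℂ) = ℓ ⟨x, hx⟩ from h]
  exact hT x hx

end Ultralimit

/-- The Schwartz space is polynormable (its topology is given by the Schwartz seminorm family). -/
instance instPolynormableSpaceSchwartz (n : ℕ) : PolynormableSpace ℂ (𝓢((Fin n → 𝔼), ℂ)) :=
  (schwartz_withSeminorms ℂ (Fin n → 𝔼) ℂ).toPolynormableSpace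

/-- The finite-order Schwartz norm `schwartzNorm m` is (the value of) a continuous seminorm. -/
def schwartzSeminorm (n m : ℕ) : Seminorm ℂ (𝓢((Fin n → 𝔼), ℂ)) :=
  (Finset.Iic (m, m)).sup (schwartzSeminormFamily ℂ (Fin n → 𝔼) ℂ)

/-- Its value is the tree's `schwartzNorm`. -/
@[simp] theorem schwartzSeminorm_apply (n m : ℕ) (F : 𝓢((Fin n → 𝔼), ℂ)) :
    schwartzSeminorm n m F = schwartzNorm m F := rfl

/-- It is continuous for the Schwartz topology. -/
theorem continuous_schwartzSeminorm (n m : ℕ) : Continuous (schwartzSeminorm n m) :=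
  Seminorm.continuous_finsetSup fun i _ => (schwartz_withSeminorms ℂ (Fin n → 𝔼) ℂ).continuous_seminorm i


/-! ## §E  The limit functionals of the canonical curvature distributions (class (i), proved): one ultrafilter,
all degrees, with the E0'-domination — the object `T.schwinger` of the corrected stub is built from these. -/

section LimitFunctional

variable {G : Type} [Group G] [TopologicalSpace G] [IsTopologicalGroup G] [CompactSpace G]
  [MeasurableSpace G] [BorelSpace G]

/-- **Existence of the limit functionals.** Under `UVB` there are continuous linear functionals `Λ p` on
`𝓢((ℝ⁴)ᵖ, ℂ)`, `p ∈ ℕ`, such that along ONE ultrafilter `𝒰 ≥ atTop` (the same for all `p`) the canonical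
curvature distributions converge to `Λ p F` for every off-diagonal `F`, and `Λ p` obeys the E0' bound. In particular
`Λ p F = lim_k curvDistribution k p F` whenever that limit exists (e.g. on real product tensors, `ConvProducts`). -/
theorem exists_limitFunctionals (r : LatticeRep G) (sch : SpeciesScheme (YMSpecies G)) (hUVB : UVB r sch) :
    ∃ (𝒰 : Ultrafilter ℕ) (_ : (𝒰 : Filter ℕ) ≤ atTop) (s : ℕ) (α β : ℝ), 0 ≤ α ∧
      ∃ Λ : (p : ℕ) → 𝓢((Fin p → 𝔼), ℂ) →L[ℂ] ℂ,
        (∀ (p : ℕ) (F : 𝓢((Fin p → 𝔼), ℂ)), IsOffDiagonal F →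
          Tendsto (fun k => curvDistribution r sch k p F) 𝒰 (𝓝 (Λ p F))) ∧
        (∀ (p : ℕ) (F : 𝓢((Fin p → 𝔼), ℂ)), IsOffDiagonal F →
          ‖Λ p F‖ ≤ α * (p.factorial : ℝ) ^ β * schwartzNorm (p * s) F) := by
  obtain ⟨s, α, β, h⟩ := hUVB
  refine ⟨hyperfilter ℕ, Nat.hyperfilter_le_atTop, s, max α 0, β, le_max_right _ _, ?_⟩
  -- degreewise construction along the common ultrafilter
  have key : ∀ p : ℕ, ∃ Λ : 𝓢((Fin p → 𝔼), ℂ) →L[ℂ] ℂ,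
      (∀ F : 𝓢((Fin p → 𝔼), ℂ), IsOffDiagonal F →
        Tendsto (fun k => curvDistribution r sch k p F) (hyperfilter ℕ) (𝓝 (Λ F))) ∧
      ∀ F : 𝓢((Fin p → 𝔼), ℂ), ‖Λ F‖ ≤ max α 0 * (p.factorial : ℝ) ^ β * schwartzNorm (p * s) F := by
    intro p
    set c : NNReal := Real.toNNReal (max α 0 * (p.factorial : ℝ) ^ β) with hc
    have hcval : (c : ℝ) = max α 0 * (p.factorial : ℝ) ^ β := by
      rw [hc, Real.coe_toNNReal _ (by positivity)]
    let q : Seminorm ℂ (𝓢((Fin p → 𝔼), ℂ)) := c • schwartzSeminorm p (p * s)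
    have hq : Continuous q := (continuous_schwartzSeminorm p (p * s)).const_smul (c : ℝ)
    have hqF : ∀ F, q F = max α 0 * (p.factorial : ℝ) ^ β * schwartzNorm (p * s) F := fun F => by
      show (c : ℝ) • schwartzSeminorm p (p * s) F = _
      rw [hcval, schwartzSeminorm_apply, smul_eq_mul]
    obtain ⟨Λ, hΛ, hΛq⟩ := exists_clm_ultralimit (hyperfilter ℕ) Nat.hyperfilter_le_atTop (offDiag p) q hq
      (fun k => (curvCLM r sch k p : 𝓢((Fin p → 𝔼), ℂ) →ₗ[ℂ] ℂ)) (fun F hF => by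
        filter_upwards [h p F hF] with k hk
        rw [hqF]
        refine (le_of_eq_of_le (by simp) hk).trans ?_
        exact mul_le_mul_of_nonneg_right (mul_le_mul_of_nonneg_right (le_max_left _ _) (by positivity))
          (schwartzNorm_nonneg _ _))
    refine ⟨Λ, fun F hF => ?_, fun F => (hΛq F).trans_eq (hqF F)⟩
    have := hΛ F hF
    simpa using this
  choose Λ hΛ using key
  exact ⟨Λ, fun p F hF => (hΛ p).1 F hF, fun p F _ => (hΛ p).2 F⟩

/-- **Registered representative of this file** (closed form of `exists_limitFunctionals`, for the gate's
`--supports` stub check). -/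
theorem osLegsB_exists_limitFunctionals :
    ∀ {G : Type} [Group G] [TopologicalSpace G] [IsTopologicalGroup G] [CompactSpace G]
      [MeasurableSpace G] [BorelSpace G] (r : LatticeRep G) (sch : SpeciesScheme (YMSpecies G)), UVB r sch →
      ∃ (𝒰 : Ultrafilter ℕ) (_ : (𝒰 : Filter ℕ) ≤ atTop) (s : ℕ) (α β : ℝ), 0 ≤ α ∧
        ∃ Λ : (p : ℕ) → 𝓢((Fin p → EuclideanSpace ℝ (Fin 4)), ℂ) →L[ℂ] ℂ,
          (∀ (p : ℕ) (F : 𝓢((Fin p → EuclideanSpace ℝ (Fin 4)), ℂ)), IsOffDiagonal F →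
            Tendsto (fun k => curvDistribution r sch k p F) 𝒰 (𝓝 (Λ p F))) ∧
          (∀ (p : ℕ) (F : 𝓢((Fin p → EuclideanSpace ℝ (Fin 4)), ℂ)), IsOffDiagonal F →
            ‖Λ p F‖ ≤ α * (p.factorial : ℝ) ^ β * schwartzNorm (p * s) F) := by
  intro G _ _ _ _ _ _ r sch hUVB
  exact exists_limitFunctionals r sch hUVB

end LimitFunctional


end Summit.QuantumFields.YangMills.Cruxes.ContinuumLimitOnTrajectory.TwoOrbitSynchronisation

end
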